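/-
Copyright (c) 2026 the pub-hodgecm-mathlib formalisation cell (harness21).  Prover seat hodgecm-mathlib-K2Liu-p10 (g0), Track B «K2-LIT»,
#184♮ = hLiu418 = `stmt-HodgeConjecture-24832`; LEAD F0P6-plan (g11) RE-POINT 2026-09-04T05:28:07Z of req649 (S3) + GO 05:35:04Z: #33b (a), file (C):
the ARCHIMEDEAN main-orbit chart `P_{Δ,∞} × G_∞ → H_∞ = U(J^𝔻)(L ⊗ ℝ)` is an open embedding onto `Ω_∞ = {M unit}`; `P_{Δ,∞}·ι_∞(C, 1)` is closed.
-/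
import Summits.HodgeConjecture.HodgeConjecture.Theorems.K2LiuSiegelMainOrbitOpenEmbeddingArchPrelims   -- ★ carriers, Gram matrices, inputs, transport
import HarnessLib

/-!
# Crux `HLiu418`, road `K2_Liu`, socket #33b organ (a), file (C): the ARCHIMEDEAN main-orbit open embedding
# `P_{Δ,∞} × G_∞ ≅ Ω_∞ ⊆ H_∞ = U(J^𝔻)(L ⊗_ℚ ℝ)`

Cell `hodgecm-mathlib`, crux item hLiu418 = `stmt-HodgeConjecture-24832`; squad K2, LEAD F0P6-plan (g11) (ruling «M-155n», GO 2026-09-04T05:35:04Z), box K2E5-r01 (g6),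
consumer K2E2-p12 (g3) (#33b (D-arch) + assembly), twin K2Liu-p08 (g0) (file (B), finite places).  THEOREMS ONLY (no `def`, no instance, no notation,
no named-fact hypothesis, no `sorry`); lane `--supports stmt-HodgeConjecture-24832 --as helper` (count-neutral helper).

SETTING (★ `K2LiuSiegelMainOrbitOpenEmbeddingArchPrelims`).  CM field `L`, `L⁺ = Fp L`, `c` = complex conjugation; datum `e : Fin N × Fin M ≃ Fin n`, `dV`, `dW`;
`J^𝔻 = hermD L e dV hdV dW hdW`; `R_∞ := mixedSpace L = L ⊗_ℚ ℝ`, `σ_∞ := conjMixed L⁺ L c`, `H_∞ := UnitaryGroup.arch L⁺ L c (n + n) J^𝔻 ≤ GL_{n+n}(R_∞)`,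
`𝕁_∞ := reindex e e (archFormOf L N (diag dV) ⊗ₖ archFormOf L M (diag dW))` (spelled out), `G_∞ := unitaryGroupOfForm σ_∞ 𝕁_∞ ≤ GL_n(R_∞)`,
`P_{Δ,∞} := {p : H_∞ // IsSiegelM ↑↑p}`, `M_∞(h) := (reindex e₂⁻¹ e₂⁻¹ ↑↑h)₂₂ − (…)₁₂`.  NO archimedean doubling map is defined in the tree (★
`K2LiuDoublingZetaGL1Factor` §1): the embedding `x ↦ ι_∞(x, 1)` is ANY map `j : G_∞ → H_∞` PINNED BY ITS MATRIX `↑↑(j x) = reindex e₂ e₂ (fromBlocks ↑↑x 0 0 1)`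
(hypothesis `hj`, by value) — the literal twin `inclusion ∘ reindexU e₂ ∘ blockDiag` of ★ `iotaGGLoc`'s body satisfies it (★ `coe_iotaArch`; corollary (C1′)),
and so will any later `iotaGGArch` definition.

RESULTS (file (G) ★ `K2LiuSiegelMainOrbitOpenEmbeddingGeneric` transported along ★ `exists_homeomorph_arch`):
* `exists_transport` — the chart `(p, x) ↦ p·j(x)` FACTORS as (homeomorphism of Siegel subtypes × `id`) ≫ (file (G)'s generic chart over `R_∞`) ≫ (`U(𝕁_∞ ⊕ −𝕁_∞) ≃ₜ H_∞`);
* **(C1) `isOpenEmbedding_siegel_mul_iotaArch`** — `P_{Δ,∞} × G_∞ → H_∞` is an OPEN EMBEDDING (`det 𝕁_∞` a unit: ★ `isUnit_det_pairFormArch`);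
* **(C2) `range_siegel_mul_iotaArch`** — its range is the main orbit `Ω_∞ = {h | M_∞(h) unit}`;
* (C3) `isOpen_setOf_isUnit_mainOrbitBlock_arch` — `Ω_∞` is open;
* **(C4 = D1-arch) `isClosed_siegel_mul_iotaArch_image_of_isCompact`** — `P_{Δ,∞}·j(C)` is CLOSED for `C ⊆ G_∞` compact (what makes `δ_∞ ⊗ g_∞` on `Ω_∞`,
  `0` off it, continuous for `g_∞ ∈ C_c(G_∞)`);
* (C1′) `isOpenEmbedding_siegel_mul_iotaArch_inclusion` — (C1) for the literal `ι_∞`, `hj` discharged.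
(C5) `isSiegelDelta_archToAdelic_iff` (the two spellings of `P_Δ(L⁺ ⊗ ℝ)`) is in the preliminaries.
[GelbartPiatetskishapiroRallis1987, Part A §1] [Liu2021, §B.3 (B.5), Lem. B.11] [HarrisKudlaSweet1996, §1 (1.9)–(1.12)] [BorelJacquet1979, §4.1].
HONEST LABEL.  Count-neutral helper; `HC_CM` is proved only modulo the 7 printed citations (2 remaining named inputs: hLiu418 = `stmt-HodgeConjecture-24832`,
h413 = `stmt-HodgeConjecture-24833`) until rung 0 closes.
-/

set_option autoImplicit false
set_option linter.dupNamespace false -- the mandated namespace repeats `HodgeConjecture.HodgeConjecture`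

noncomputable section

namespace Summit.HodgeConjecture.HodgeConjecture.Cruxes.HLiu418.K2LiuSiegelMainOrbitOpenEmbeddingArch

open Matrix Topology Set Filter
open scoped Pointwise Kronecker
open NumberField NumberField.mixedEmbedding IsDedekindDomain
open Literature.NumberTheory.Automorphic Literature.NumberTheory.Automorphic.UnitaryGroup
open Literature.NumberTheory.GelbartRogawski1991 Literature.NumberTheory.GelbartRogawski1991.GRConstruction
open Literature.NumberTheory.GelbartRogawski1991.UnitaryDualPair
open Summit.HodgeConjecture.HodgeConjecture.Cruxes.HLiu418.K2LiuSiegelMainOrbitOpenEmbeddingGeneric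
open Summit.HodgeConjecture.HodgeConjecture.Cruxes.HLiu418.K2LiuSiegelMainOrbitOpenEmbeddingArchPrelims

variable {L : Type} [Field L] [NumberField L] [IsCMField L]
variable {N M n : ℕ} {e : Fin N × Fin M ≃ Fin n}
  {dV : Fin N → L} {hdV : ∀ i, IsCMField.complexConj L (dV i) = dV i}
  {dW : Fin M → L} {hdW : ∀ i, IsCMField.complexConj L (dW i) = dW i}

/-- **TRANSPORT of the chart.**  For an embedding `j : G_∞ → H_∞` pinned by its matrix (`hj`), the archimedean chart `(p, x) ↦ p·j(x)` FACTORS as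
(homeomorphism of Siegel subtypes × `id`) ≫ (file (G)'s generic chart `(P, A) ↦ P·ι(A,1)` over `R_∞`, form `𝕁_∞`) ≫ (the homeomorphism `U(𝕁_∞ ⊕ −𝕁_∞) ≃ₜ H_∞`
of `exists_homeomorph_arch`, whose inverse is `reindex e₂⁻¹ e₂⁻¹` on matrices). [cite: HarrisKudlaSweet1996, §1 (1.9)–(1.11)] [cite: GelbartPiatetskishapiroRallis1987, Part A §1] -/
theorem exists_transport
    (j : unitaryGroupOfForm (conjMixed (Fp L) L (IsCMField.complexConj L))
        (Matrix.reindex e e (archFormOf L N (Matrix.diagonal dV) ⊗ₖ archFormOf L M (Matrix.diagonal dW))) →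
      arch (Fp L) L (IsCMField.complexConj L) (n + n) (hermD L e dV hdV dW hdW))
    (hj : ∀ x, (((j x : arch (Fp L) L (IsCMField.complexConj L) (n + n) (hermD L e dV hdV dW hdW)) : GL (Fin (n + n)) (mixedSpace L)) :
        Matrix (Fin (n + n)) (Fin (n + n)) (mixedSpace L)) =
      Matrix.reindex (e₂ (n := n)) (e₂ (n := n)) (fromBlocks ((x : GL (Fin n) (mixedSpace L)) : Matrix (Fin n) (Fin n) (mixedSpace L)) 0 0 1)) :
    ∃ (eH : unitaryGroupOfForm (conjMixed (Fp L) L (IsCMField.complexConj L))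
          (fromBlocks (Matrix.reindex e e (archFormOf L N (Matrix.diagonal dV) ⊗ₖ archFormOf L M (Matrix.diagonal dW))) 0 0
            (-Matrix.reindex e e (archFormOf L N (Matrix.diagonal dV) ⊗ₖ archFormOf L M (Matrix.diagonal dW)))) ≃ₜ
          arch (Fp L) L (IsCMField.complexConj L) (n + n) (hermD L e dV hdV dW hdW))
      (eP : {p : arch (Fp L) L (IsCMField.complexConj L) (n + n) (hermD L e dV hdV dW hdW) //
          IsSiegelM ((p : GL (Fin (n + n)) (mixedSpace L)) : Matrix (Fin (n + n)) (Fin (n + n)) (mixedSpace L))} ≃ₜ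
        {P : unitaryGroupOfForm (conjMixed (Fp L) L (IsCMField.complexConj L))
            (fromBlocks (Matrix.reindex e e (archFormOf L N (Matrix.diagonal dV) ⊗ₖ archFormOf L M (Matrix.diagonal dW))) 0 0
              (-Matrix.reindex e e (archFormOf L N (Matrix.diagonal dV) ⊗ₖ archFormOf L M (Matrix.diagonal dW)))) //
          ((P : GL (Fin n ⊕ Fin n) (mixedSpace L)) : Matrix (Fin n ⊕ Fin n) (Fin n ⊕ Fin n) (mixedSpace L)).toBlocks₁₁ +
              ((P : GL (Fin n ⊕ Fin n) (mixedSpace L)) : Matrix (Fin n ⊕ Fin n) (Fin n ⊕ Fin n) (mixedSpace L)).toBlocks₁₂ =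
            ((P : GL (Fin n ⊕ Fin n) (mixedSpace L)) : Matrix (Fin n ⊕ Fin n) (Fin n ⊕ Fin n) (mixedSpace L)).toBlocks₂₁ +
              ((P : GL (Fin n ⊕ Fin n) (mixedSpace L)) : Matrix (Fin n ⊕ Fin n) (Fin n ⊕ Fin n) (mixedSpace L)).toBlocks₂₂}),
      (∀ h, ((eH.symm h : unitaryGroupOfForm (conjMixed (Fp L) L (IsCMField.complexConj L))
          (fromBlocks (Matrix.reindex e e (archFormOf L N (Matrix.diagonal dV) ⊗ₖ archFormOf L M (Matrix.diagonal dW))) 0 0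
            (-Matrix.reindex e e (archFormOf L N (Matrix.diagonal dV) ⊗ₖ archFormOf L M (Matrix.diagonal dW))))) :
            GL (Fin n ⊕ Fin n) (mixedSpace L)) = reindexGL (e₂ (n := n)).symm (h : GL (Fin (n + n)) (mixedSpace L))) ∧
      (fun px : {p : arch (Fp L) L (IsCMField.complexConj L) (n + n) (hermD L e dV hdV dW hdW) //
            IsSiegelM ((p : GL (Fin (n + n)) (mixedSpace L)) : Matrix (Fin (n + n)) (Fin (n + n)) (mixedSpace L))} ×
          unitaryGroupOfForm (conjMixed (Fp L) L (IsCMField.complexConj L))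
            (Matrix.reindex e e (archFormOf L N (Matrix.diagonal dV) ⊗ₖ archFormOf L M (Matrix.diagonal dW))) =>
          (px.1.1 : arch (Fp L) L (IsCMField.complexConj L) (n + n) (hermD L e dV hdV dW hdW)) * j px.2) =
        ⇑eH ∘ (fun qx : {P : unitaryGroupOfForm (conjMixed (Fp L) L (IsCMField.complexConj L))
              (fromBlocks (Matrix.reindex e e (archFormOf L N (Matrix.diagonal dV) ⊗ₖ archFormOf L M (Matrix.diagonal dW))) 0 0
                (-Matrix.reindex e e (archFormOf L N (Matrix.diagonal dV) ⊗ₖ archFormOf L M (Matrix.diagonal dW)))) //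
              ((P : GL (Fin n ⊕ Fin n) (mixedSpace L)) : Matrix (Fin n ⊕ Fin n) (Fin n ⊕ Fin n) (mixedSpace L)).toBlocks₁₁ +
                  ((P : GL (Fin n ⊕ Fin n) (mixedSpace L)) : Matrix (Fin n ⊕ Fin n) (Fin n ⊕ Fin n) (mixedSpace L)).toBlocks₁₂ =
                ((P : GL (Fin n ⊕ Fin n) (mixedSpace L)) : Matrix (Fin n ⊕ Fin n) (Fin n ⊕ Fin n) (mixedSpace L)).toBlocks₂₁ +
                  ((P : GL (Fin n ⊕ Fin n) (mixedSpace L)) : Matrix (Fin n ⊕ Fin n) (Fin n ⊕ Fin n) (mixedSpace L)).toBlocks₂₂} ×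
            unitaryGroupOfForm (conjMixed (Fp L) L (IsCMField.complexConj L))
              (Matrix.reindex e e (archFormOf L N (Matrix.diagonal dV) ⊗ₖ archFormOf L M (Matrix.diagonal dW))) =>
            (qx.1.1 : unitaryGroupOfForm (conjMixed (Fp L) L (IsCMField.complexConj L))
              (fromBlocks (Matrix.reindex e e (archFormOf L N (Matrix.diagonal dV) ⊗ₖ archFormOf L M (Matrix.diagonal dW))) 0 0
                (-Matrix.reindex e e (archFormOf L N (Matrix.diagonal dV) ⊗ₖ archFormOf L M (Matrix.diagonal dW))))) *
              blockDiag (conjMixed (Fp L) L (IsCMField.complexConj L))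
                (Matrix.reindex e e (archFormOf L N (Matrix.diagonal dV) ⊗ₖ archFormOf L M (Matrix.diagonal dW)))
                (-Matrix.reindex e e (archFormOf L N (Matrix.diagonal dV) ⊗ₖ archFormOf L M (Matrix.diagonal dW))) (qx.2, 1)) ∘
          ⇑(eP.prodCongr (Homeomorph.refl _)) := by
  obtain ⟨eH, heH, heHs, -⟩ := exists_homeomorph_arch L e dV hdV dW hdW
  -- the matrices of `eH.symm p` and `eH P`
  have hsymm : ∀ p : arch (Fp L) L (IsCMField.complexConj L) (n + n) (hermD L e dV hdV dW hdW),
      (((eH.symm p : unitaryGroupOfForm (conjMixed (Fp L) L (IsCMField.complexConj L))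
          (fromBlocks (Matrix.reindex e e (archFormOf L N (Matrix.diagonal dV) ⊗ₖ archFormOf L M (Matrix.diagonal dW))) 0 0
            (-Matrix.reindex e e (archFormOf L N (Matrix.diagonal dV) ⊗ₖ archFormOf L M (Matrix.diagonal dW))))) :
            GL (Fin n ⊕ Fin n) (mixedSpace L)) : Matrix (Fin n ⊕ Fin n) (Fin n ⊕ Fin n) (mixedSpace L)) =
        Matrix.reindex (e₂ (n := n)).symm (e₂ (n := n)).symm ((p : GL (Fin (n + n)) (mixedSpace L)) : Matrix (Fin (n + n)) (Fin (n + n)) (mixedSpace L)) :=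
    fun p => by rw [heHs]; rfl
  have hdir : ∀ P : unitaryGroupOfForm (conjMixed (Fp L) L (IsCMField.complexConj L))
      (fromBlocks (Matrix.reindex e e (archFormOf L N (Matrix.diagonal dV) ⊗ₖ archFormOf L M (Matrix.diagonal dW))) 0 0
        (-Matrix.reindex e e (archFormOf L N (Matrix.diagonal dV) ⊗ₖ archFormOf L M (Matrix.diagonal dW)))),
      (((eH P : arch (Fp L) L (IsCMField.complexConj L) (n + n) (hermD L e dV hdV dW hdW)) : GL (Fin (n + n)) (mixedSpace L)) :
          Matrix (Fin (n + n)) (Fin (n + n)) (mixedSpace L)) =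
        Matrix.reindex (e₂ (n := n)) (e₂ (n := n)) ((P : GL (Fin n ⊕ Fin n) (mixedSpace L)) : Matrix (Fin n ⊕ Fin n) (Fin n ⊕ Fin n) (mixedSpace L)) :=
    fun P => by rw [heH]; rfl
  let eP : {p : arch (Fp L) L (IsCMField.complexConj L) (n + n) (hermD L e dV hdV dW hdW) //
        IsSiegelM ((p : GL (Fin (n + n)) (mixedSpace L)) : Matrix (Fin (n + n)) (Fin (n + n)) (mixedSpace L))} ≃ₜ
      {P : unitaryGroupOfForm (conjMixed (Fp L) L (IsCMField.complexConj L))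
          (fromBlocks (Matrix.reindex e e (archFormOf L N (Matrix.diagonal dV) ⊗ₖ archFormOf L M (Matrix.diagonal dW))) 0 0
            (-Matrix.reindex e e (archFormOf L N (Matrix.diagonal dV) ⊗ₖ archFormOf L M (Matrix.diagonal dW)))) //
        ((P : GL (Fin n ⊕ Fin n) (mixedSpace L)) : Matrix (Fin n ⊕ Fin n) (Fin n ⊕ Fin n) (mixedSpace L)).toBlocks₁₁ +
            ((P : GL (Fin n ⊕ Fin n) (mixedSpace L)) : Matrix (Fin n ⊕ Fin n) (Fin n ⊕ Fin n) (mixedSpace L)).toBlocks₁₂ =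
          ((P : GL (Fin n ⊕ Fin n) (mixedSpace L)) : Matrix (Fin n ⊕ Fin n) (Fin n ⊕ Fin n) (mixedSpace L)).toBlocks₂₁ +
            ((P : GL (Fin n ⊕ Fin n) (mixedSpace L)) : Matrix (Fin n ⊕ Fin n) (Fin n ⊕ Fin n) (mixedSpace L)).toBlocks₂₂} :=
    { toFun := fun p => ⟨eH.symm p.1, by
        have hp := p.2
        unfold IsSiegelM at hp
        rw [hsymm]
        exact hp⟩
      invFun := fun P => ⟨eH P.1, by
        unfold IsSiegelM
        rw [hdir, ← Matrix.reindex_symm, Equiv.symm_apply_apply]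
        exact P.2⟩
      left_inv := fun p => Subtype.ext (eH.apply_symm_apply p.1)
      right_inv := fun P => Subtype.ext (eH.symm_apply_apply P.1)
      continuous_toFun := continuous_induced_rng.2 (eH.symm.continuous.comp continuous_subtype_val)
      continuous_invFun := continuous_induced_rng.2 (eH.continuous.comp continuous_subtype_val) }
  refine ⟨eH, eP, heHs, funext fun px => ?_⟩
  apply Subtype.ext
  apply Units.ext
  change (((px.1.1 * j px.2 : arch (Fp L) L (IsCMField.complexConj L) (n + n) (hermD L e dV hdV dW hdW)) :
      GL (Fin (n + n)) (mixedSpace L)) : Matrix (Fin (n + n)) (Fin (n + n)) (mixedSpace L)) =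
    (((eH ((eH.symm px.1.1) * blockDiag (conjMixed (Fp L) L (IsCMField.complexConj L))
        (Matrix.reindex e e (archFormOf L N (Matrix.diagonal dV) ⊗ₖ archFormOf L M (Matrix.diagonal dW)))
        (-Matrix.reindex e e (archFormOf L N (Matrix.diagonal dV) ⊗ₖ archFormOf L M (Matrix.diagonal dW))) (px.2, 1)) :
        arch (Fp L) L (IsCMField.complexConj L) (n + n) (hermD L e dV hdV dW hdW)) : GL (Fin (n + n)) (mixedSpace L)) :
      Matrix (Fin (n + n)) (Fin (n + n)) (mixedSpace L))
  rw [Subgroup.coe_mul, Units.val_mul, hj, hdir, coe_mul_blockDiag_one, hsymm, reindex_reindex_symm_mul]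

/-- **(C1) THE ARCHIMEDEAN MAIN-ORBIT CHART IS AN OPEN EMBEDDING**: for any `j : G_∞ → H_∞` with matrices `reindex e₂ e₂ (x ⊕ 1)` (e.g. the literal
archimedean twin of ★ `iotaGGLoc`, `coe_iotaArch`), `(p, x) ↦ p · j(x) : P_{Δ,∞} × G_∞ → H_∞ = U(J^𝔻)(L ⊗ ℝ)` is continuous, injective and open
(`det 𝕁_∞` a unit: `isUnit_det_pairFormArch`). [cite: GelbartPiatetskishapiroRallis1987, Part A §1] [cite: Liu2021, §B.3 (B.5), Lem. B.11]
[cite: HarrisKudlaSweet1996, §1 (1.11)–(1.12)] -/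
theorem isOpenEmbedding_siegel_mul_iotaArch
    (hJ : IsUnit (Matrix.reindex e e (archFormOf L N (Matrix.diagonal dV) ⊗ₖ archFormOf L M (Matrix.diagonal dW))).det)
    (j : unitaryGroupOfForm (conjMixed (Fp L) L (IsCMField.complexConj L))
        (Matrix.reindex e e (archFormOf L N (Matrix.diagonal dV) ⊗ₖ archFormOf L M (Matrix.diagonal dW))) →
      arch (Fp L) L (IsCMField.complexConj L) (n + n) (hermD L e dV hdV dW hdW))
    (hj : ∀ x, (((j x : arch (Fp L) L (IsCMField.complexConj L) (n + n) (hermD L e dV hdV dW hdW)) : GL (Fin (n + n)) (mixedSpace L)) :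
        Matrix (Fin (n + n)) (Fin (n + n)) (mixedSpace L)) =
      Matrix.reindex (e₂ (n := n)) (e₂ (n := n)) (fromBlocks ((x : GL (Fin n) (mixedSpace L)) : Matrix (Fin n) (Fin n) (mixedSpace L)) 0 0 1)) :
    IsOpenEmbedding fun px : {p : arch (Fp L) L (IsCMField.complexConj L) (n + n) (hermD L e dV hdV dW hdW) //
          IsSiegelM ((p : GL (Fin (n + n)) (mixedSpace L)) : Matrix (Fin (n + n)) (Fin (n + n)) (mixedSpace L))} ×
        unitaryGroupOfForm (conjMixed (Fp L) L (IsCMField.complexConj L))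
          (Matrix.reindex e e (archFormOf L N (Matrix.diagonal dV) ⊗ₖ archFormOf L M (Matrix.diagonal dW))) =>
      (px.1.1 : arch (Fp L) L (IsCMField.complexConj L) (n + n) (hermD L e dV hdV dW hdW)) * j px.2 := by
  obtain ⟨eH, eP, -, hfun⟩ := exists_transport j hj
  rw [hfun]
  exact eH.isOpenEmbedding.comp ((isOpenEmbedding_siegel_mul_blockDiag hJ (isOpen_setOf_isUnit_mixedSpace L) (continuousAt_inverse_mixedSpace L)).comp
    (eP.prodCongr (Homeomorph.refl _)).isOpenEmbedding)

/-- **(C2) THE RANGE OF THE ARCHIMEDEAN CHART IS THE MAIN ORBIT** `Ω_∞ = {h : H_∞ | M_∞(h) = (reindex e₂⁻¹ e₂⁻¹ h)₂₂ − (…)₁₂ is a unit}`.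
[cite: GelbartPiatetskishapiroRallis1987, Part A §1] [cite: Liu2021, §B.3 (B.5), Lem. B.11] -/
theorem range_siegel_mul_iotaArch
    (hJ : IsUnit (Matrix.reindex e e (archFormOf L N (Matrix.diagonal dV) ⊗ₖ archFormOf L M (Matrix.diagonal dW))).det)
    (j : unitaryGroupOfForm (conjMixed (Fp L) L (IsCMField.complexConj L))
        (Matrix.reindex e e (archFormOf L N (Matrix.diagonal dV) ⊗ₖ archFormOf L M (Matrix.diagonal dW))) →
      arch (Fp L) L (IsCMField.complexConj L) (n + n) (hermD L e dV hdV dW hdW))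
    (hj : ∀ x, (((j x : arch (Fp L) L (IsCMField.complexConj L) (n + n) (hermD L e dV hdV dW hdW)) : GL (Fin (n + n)) (mixedSpace L)) :
        Matrix (Fin (n + n)) (Fin (n + n)) (mixedSpace L)) =
      Matrix.reindex (e₂ (n := n)) (e₂ (n := n)) (fromBlocks ((x : GL (Fin n) (mixedSpace L)) : Matrix (Fin n) (Fin n) (mixedSpace L)) 0 0 1)) :
    Set.range (fun px : {p : arch (Fp L) L (IsCMField.complexConj L) (n + n) (hermD L e dV hdV dW hdW) //
          IsSiegelM ((p : GL (Fin (n + n)) (mixedSpace L)) : Matrix (Fin (n + n)) (Fin (n + n)) (mixedSpace L))} ×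
        unitaryGroupOfForm (conjMixed (Fp L) L (IsCMField.complexConj L))
          (Matrix.reindex e e (archFormOf L N (Matrix.diagonal dV) ⊗ₖ archFormOf L M (Matrix.diagonal dW))) =>
      (px.1.1 : arch (Fp L) L (IsCMField.complexConj L) (n + n) (hermD L e dV hdV dW hdW)) * j px.2) =
      {h : arch (Fp L) L (IsCMField.complexConj L) (n + n) (hermD L e dV hdV dW hdW) |
        IsUnit ((Matrix.reindex (e₂ (n := n)).symm (e₂ (n := n)).symm ((h : GL (Fin (n + n)) (mixedSpace L)) : Matrix (Fin (n + n)) (Fin (n + n)) (mixedSpace L))).toBlocks₂₂ -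
          (Matrix.reindex (e₂ (n := n)).symm (e₂ (n := n)).symm ((h : GL (Fin (n + n)) (mixedSpace L)) : Matrix (Fin (n + n)) (Fin (n + n)) (mixedSpace L))).toBlocks₁₂)} := by
  obtain ⟨eH, eP, heHs, hfun⟩ := exists_transport j hj
  rw [hfun, Set.range_comp, (eP.prodCongr (Homeomorph.refl _)).surjective.range_comp, range_siegel_mul_blockDiag hJ,
    Homeomorph.image_eq_preimage_symm]
  ext h
  rw [Set.mem_preimage, Set.mem_setOf_eq, Set.mem_setOf_eq, heHs, coe_reindexGL]

variable (L e dV hdV dW hdW) in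
/-- **(C3) `Ω_∞ = {h : H_∞ | M_∞(h) unit}` is OPEN in `H_∞`.** [cite: GelbartPiatetskishapiroRallis1987, Part A §1 (the main orbit is open)] -/
theorem isOpen_setOf_isUnit_mainOrbitBlock_arch :
    IsOpen {h : arch (Fp L) L (IsCMField.complexConj L) (n + n) (hermD L e dV hdV dW hdW) |
        IsUnit ((Matrix.reindex (e₂ (n := n)).symm (e₂ (n := n)).symm ((h : GL (Fin (n + n)) (mixedSpace L)) : Matrix (Fin (n + n)) (Fin (n + n)) (mixedSpace L))).toBlocks₂₂ -
          (Matrix.reindex (e₂ (n := n)).symm (e₂ (n := n)).symm ((h : GL (Fin (n + n)) (mixedSpace L)) : Matrix (Fin (n + n)) (Fin (n + n)) (mixedSpace L))).toBlocks₁₂)} := by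
  have hc : Continuous fun h : arch (Fp L) L (IsCMField.complexConj L) (n + n) (hermD L e dV hdV dW hdW) =>
      ((Matrix.reindex (e₂ (n := n)).symm (e₂ (n := n)).symm ((h : GL (Fin (n + n)) (mixedSpace L)) : Matrix (Fin (n + n)) (Fin (n + n)) (mixedSpace L))).toBlocks₂₂ -
        (Matrix.reindex (e₂ (n := n)).symm (e₂ (n := n)).symm ((h : GL (Fin (n + n)) (mixedSpace L)) : Matrix (Fin (n + n)) (Fin (n + n)) (mixedSpace L))).toBlocks₁₂).det :=
    ((continuous_toBlocks_sub.comp (continuous_reindex_symm L)).comp (Units.continuous_val.comp continuous_subtype_val)).matrix_det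
  convert (isOpen_setOf_isUnit_mixedSpace L).preimage hc using 1
  ext x
  exact isUnit_iff_isUnit_det _

/-- **(C4 = D1-arch) `P_{Δ,∞} · j(C)` is CLOSED in `H_∞` for `C ⊆ G_∞` compact** (image of `P_{Δ,∞} × C` under the chart; file (G) §4 transported along
`exists_transport`).  This is what makes `φ_∞ := δ_∞ ⊗ g_∞` on `Ω_∞`, `0` off it, continuous for `g_∞ ∈ C_c(G_∞)`.
[cite: GelbartPiatetskishapiroRallis1987, Part A §1 (`P\Ω ≅ G`)] -/
theorem isClosed_siegel_mul_iotaArch_image_of_isCompact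
    (j : unitaryGroupOfForm (conjMixed (Fp L) L (IsCMField.complexConj L))
        (Matrix.reindex e e (archFormOf L N (Matrix.diagonal dV) ⊗ₖ archFormOf L M (Matrix.diagonal dW))) →
      arch (Fp L) L (IsCMField.complexConj L) (n + n) (hermD L e dV hdV dW hdW))
    (hj : ∀ x, (((j x : arch (Fp L) L (IsCMField.complexConj L) (n + n) (hermD L e dV hdV dW hdW)) : GL (Fin (n + n)) (mixedSpace L)) :
        Matrix (Fin (n + n)) (Fin (n + n)) (mixedSpace L)) =
      Matrix.reindex (e₂ (n := n)) (e₂ (n := n)) (fromBlocks ((x : GL (Fin n) (mixedSpace L)) : Matrix (Fin n) (Fin n) (mixedSpace L)) 0 0 1))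
    {C : Set (unitaryGroupOfForm (conjMixed (Fp L) L (IsCMField.complexConj L))
      (Matrix.reindex e e (archFormOf L N (Matrix.diagonal dV) ⊗ₖ archFormOf L M (Matrix.diagonal dW))))} (hC : IsCompact C) :
    IsClosed ((fun px : {p : arch (Fp L) L (IsCMField.complexConj L) (n + n) (hermD L e dV hdV dW hdW) //
          IsSiegelM ((p : GL (Fin (n + n)) (mixedSpace L)) : Matrix (Fin (n + n)) (Fin (n + n)) (mixedSpace L))} ×
        unitaryGroupOfForm (conjMixed (Fp L) L (IsCMField.complexConj L))
          (Matrix.reindex e e (archFormOf L N (Matrix.diagonal dV) ⊗ₖ archFormOf L M (Matrix.diagonal dW))) =>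
      (px.1.1 : arch (Fp L) L (IsCMField.complexConj L) (n + n) (hermD L e dV hdV dW hdW)) * j px.2) '' (Set.univ ×ˢ C)) := by
  obtain ⟨eH, eP, -, hfun⟩ := exists_transport j hj
  have hΦ : ⇑(eP.prodCongr (Homeomorph.refl (unitaryGroupOfForm (conjMixed (Fp L) L (IsCMField.complexConj L))
      (Matrix.reindex e e (archFormOf L N (Matrix.diagonal dV) ⊗ₖ archFormOf L M (Matrix.diagonal dW)))))) '' (Set.univ ×ˢ C) =
      Set.univ ×ˢ C := by
    ext qx
    constructor
    · rintro ⟨px, hpx, rfl⟩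
      exact ⟨Set.mem_univ _, hpx.2⟩
    · rintro ⟨-, hx⟩
      exact ⟨(eP.symm qx.1, qx.2), ⟨Set.mem_univ _, hx⟩, Prod.ext (eP.apply_symm_apply qx.1) rfl⟩
  rw [hfun, Set.image_comp, Set.image_comp, hΦ]
  exact eH.isClosedMap _ (isClosed_siegel_mul_blockDiag_image_of_isCompact _ _ hC)

variable (L e dV hdV dW hdW) in
/-- **(C1′) the boxed head, literally**: the chart built with the LITERAL archimedean twin of ★ `iotaGGLoc`'s body,
`ι_∞ := inclusion ∘ reindexU e₂ ∘ blockDiag`, is an open embedding (`hj` discharged by `coe_iotaArch`).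
[cite: GelbartPiatetskishapiroRallis1987, Part A §1] [cite: Liu2021, Lem. B.11] -/
theorem isOpenEmbedding_siegel_mul_iotaArch_inclusion
    (hJ : IsUnit (Matrix.reindex e e (archFormOf L N (Matrix.diagonal dV) ⊗ₖ archFormOf L M (Matrix.diagonal dW))).det) :
    IsOpenEmbedding fun px : {p : arch (Fp L) L (IsCMField.complexConj L) (n + n) (hermD L e dV hdV dW hdW) //
          IsSiegelM ((p : GL (Fin (n + n)) (mixedSpace L)) : Matrix (Fin (n + n)) (Fin (n + n)) (mixedSpace L))} ×
        unitaryGroupOfForm (conjMixed (Fp L) L (IsCMField.complexConj L))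
          (Matrix.reindex e e (archFormOf L N (Matrix.diagonal dV) ⊗ₖ archFormOf L M (Matrix.diagonal dW))) =>
      (px.1.1 : arch (Fp L) L (IsCMField.complexConj L) (n + n) (hermD L e dV hdV dW hdW)) *
        (show arch (Fp L) L (IsCMField.complexConj L) (n + n) (hermD L e dV hdV dW hdW) from
          ((Subgroup.inclusion (le_of_eq (congrArg (unitaryGroupOfForm (conjMixed (Fp L) L (IsCMField.complexConj L)))
              (archForm_hermD_eq L e dV hdV dW hdW).symm))).comp
            ((reindexU (conjMixed (Fp L) L (IsCMField.complexConj L)) (e₂ (n := n)) _).comp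
              (blockDiag (conjMixed (Fp L) L (IsCMField.complexConj L))
                (Matrix.reindex e e (archFormOf L N (Matrix.diagonal dV) ⊗ₖ archFormOf L M (Matrix.diagonal dW)))
                (-Matrix.reindex e e (archFormOf L N (Matrix.diagonal dV) ⊗ₖ archFormOf L M (Matrix.diagonal dW))))))
            (px.2, 1)) :=
  isOpenEmbedding_siegel_mul_iotaArch hJ
    (fun x => show arch (Fp L) L (IsCMField.complexConj L) (n + n) (hermD L e dV hdV dW hdW) from
      ((Subgroup.inclusion (le_of_eq (congrArg (unitaryGroupOfForm (conjMixed (Fp L) L (IsCMField.complexConj L)))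
          (archForm_hermD_eq L e dV hdV dW hdW).symm))).comp
        ((reindexU (conjMixed (Fp L) L (IsCMField.complexConj L)) (e₂ (n := n)) _).comp
          (blockDiag (conjMixed (Fp L) L (IsCMField.complexConj L))
            (Matrix.reindex e e (archFormOf L N (Matrix.diagonal dV) ⊗ₖ archFormOf L M (Matrix.diagonal dW)))
            (-Matrix.reindex e e (archFormOf L N (Matrix.diagonal dV) ⊗ₖ archFormOf L M (Matrix.diagonal dW))))))
        (x, 1))
    fun x => by rw [coe_iotaArch, OneMemClass.coe_one, Units.val_one]

end Summit.HodgeConjecture.HodgeConjecture.Cruxes.HLiu418.K2LiuSiegelMainOrbitOpenEmbeddingArch
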